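import Mathlib.Data.Finset.Card
import Mathlib.Data.List.Chain
import Literature.Computability.MetaComplexity.ResLin
import Literature.Computability.MetaComplexity.ResLinSpace
import Literature.Computability.MetaComplexity.ResLinWinningStrategy
import HarnessLib

/-!
# Configuration-style Res(⊕) refutations back to line-based ones

The converse of `exists_isResLinSpaceRefutation_of_isResLinRefutation`
(`Literature/Computability/MetaComplexity/ResLinSpace.lean`): a configuration-style Res(⊕)
refutation (download / erase / one-rule inference, [Gryaznov–Ovcharov–Riazanov 2024, §2.4]) with
`m` configurations yields a line-based Res(⊕) refutation (`IsResLinRefutation`, Itsykson–Sokolov)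
with at most `m − 1` lines — record every downloaded or inferred clause as a new line, ignore
erasures. Hence the two formats refute the same CNFs, and clause space is a measure on a format
equivalent to the tree's Res(⊕) (`isResLinSpaceRefutable_iff`).

## References

* J. L. Esteban, J. Torán, *Space bounds for resolution*, Inform. Comput. 171 (2001) (origin of
  the configuration format) [EstebanToran2001]; M. Alekhnovich, E. Ben-Sasson, A. Razborov,
  A. Wigderson, SIAM J. Comput. 31 (2002), Def. 3.1 ("equivalent in size" to sequence proofs)
  [AlekhnovichBenSassonRazborovWigderson2002].
* S. Gryaznov, S. Ovcharov, A. Riazanov, ACM ToCT 16(3) (2024), §2.4 [GryaznovOvcharovRiazanov2024].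
-/

namespace Literature.Computability.MetaComplexity

open _root_.Computability Complexity

/-- One memory operation is recorded by at most one new line: if every clause of the memory `M`
is the clause of some line of the derivation `ρ`, then after the operation `M → M'` the same holds
for an extension of `ρ` by at most one (valid) line. [ABRW 2002, Def. 3.1; Esteban–Torán 2001]
[cite: AlekhnovichBenSassonRazborovWigderson2002, Def. 3.1] -/
theorem ResLinSpaceStep.exists_derivation_extension {φ : CNF ℕ} {M M' : Finset LinClause}
    (hstep : ResLinSpaceStep φ M M') {ρ : List ResLinLine} (hρ : IsResLinDerivation φ ρ)
    (hM : ∀ C ∈ M, ∃ l ∈ ρ, l.clause = C) :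
    ∃ ρ' : List ResLinLine, IsResLinDerivation φ ρ' ∧ ρ'.length ≤ ρ.length + 1 ∧
      ∀ C ∈ M', ∃ l ∈ ρ', l.clause = C := by
  -- a recorded clause stays recorded in any extension `ρ ++ [l]`
  have keep : ∀ (l : ResLinLine) (C : LinClause), (∃ l' ∈ ρ, l'.clause = C) →
      ∃ l' ∈ ρ ++ [l], l'.clause = C := by
    rintro l C ⟨l', hl', h⟩
    exact ⟨l', List.mem_append_left _ hl', h⟩
  cases hstep with
  | download c hc =>
      refine ⟨ρ ++ [⟨Clause.toLinClause c, .initial⟩],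
        hρ.append_line (l := ⟨Clause.toLinClause c, .initial⟩)
          (IsValidResLinLine.of_initial rfl hc rfl), by simp, ?_⟩
      intro C hC
      rcases Finset.mem_insert.1 hC with rfl | hC
      · exact ⟨⟨Clause.toLinClause c, .initial⟩, List.mem_append_right _ (List.mem_singleton_self _), rfl⟩
      · exact keep _ C (hM C hC)
  | erase C hC =>
      exact ⟨ρ, hρ, Nat.le_succ _, fun D hD => hM D (Finset.mem_of_mem_erase hD)⟩
  | resolve C D f hC hD =>
      obtain ⟨l₁, hl₁, hcl₁⟩ := hM _ hC
      obtain ⟨l₂, hl₂, hcl₂⟩ := hM _ hD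
      obtain ⟨i, hi, rfl⟩ := List.getElem_of_mem hl₁
      obtain ⟨j, hj, rfl⟩ := List.getElem_of_mem hl₂
      refine ⟨ρ ++ [⟨C ∪ D, .resolve i j f⟩],
        hρ.append_line (l := ⟨C ∪ D, .resolve i j f⟩)
          (IsValidResLinLine.of_resolve rfl hi hj hcl₁ hcl₂ rfl), by simp, ?_⟩
      intro E hE
      rcases Finset.mem_insert.1 hE with rfl | hE
      · exact ⟨⟨C ∪ D, .resolve i j f⟩, List.mem_append_right _ (List.mem_singleton_self _), rfl⟩
      · exact keep _ E (hM E hE)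
  | weaken C D hC h =>
      obtain ⟨l₁, hl₁, hcl₁⟩ := hM _ hC
      obtain ⟨i, hi, rfl⟩ := List.getElem_of_mem hl₁
      refine ⟨ρ ++ [⟨D, .weaken i⟩],
        hρ.append_line (l := ⟨D, .weaken i⟩)
          (IsValidResLinLine.of_weaken rfl hi fun σ hσ => h σ (by rw [hcl₁] at hσ; exact hσ)),
        by simp, ?_⟩
      · intro E hE
        rcases Finset.mem_insert.1 hE with rfl | hE
        · exact ⟨⟨E, .weaken i⟩, List.mem_append_right _ (List.mem_singleton_self _), rfl⟩
        · exact keep _ E (hM E hE)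

/-- Walking along a chain of memory operations from `M`, recording every new clause: the last
memory is covered by a derivation with at most one new line per operation. [ABRW 2002, Def. 3.1; Esteban–Torán 2001]
[cite: AlekhnovichBenSassonRazborovWigderson2002, Def. 3.1] -/
theorem exists_derivation_of_isChain {φ : CNF ℕ} :
    ∀ (π : List (Finset LinClause)) (M : Finset LinClause) (ρ : List ResLinLine),
      List.IsChain (ResLinSpaceStep φ) (M :: π) → IsResLinDerivation φ ρ →
      (∀ C ∈ M, ∃ l ∈ ρ, l.clause = C) →
      ∃ ρ' : List ResLinLine, IsResLinDerivation φ ρ' ∧ ρ'.length ≤ ρ.length + π.length ∧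
        ∀ C ∈ (M :: π).getLast (List.cons_ne_nil _ _), ∃ l ∈ ρ', l.clause = C := by
  intro π
  induction π with
  | nil =>
      intro M ρ _ hρ hM
      exact ⟨ρ, hρ, by simp, by simpa using hM⟩
  | cons M' π ih =>
      intro M ρ hchain hρ hM
      have hstep : ResLinSpaceStep φ M M' := (List.isChain_cons_cons.1 hchain).1
      have htail : List.IsChain (ResLinSpaceStep φ) (M' :: π) := (List.isChain_cons_cons.1 hchain).2
      obtain ⟨ρ₁, hρ₁, hlen₁, hM'⟩ := hstep.exists_derivation_extension hρ hM
      obtain ⟨ρ', hρ', hlen', hlast⟩ := ih M' ρ₁ htail hρ₁ hM'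
      refine ⟨ρ', hρ', ?_, ?_⟩
      · simp only [List.length_cons]
        omega
      · rw [List.getLast_cons (List.cons_ne_nil _ _)]
        exact hlast

/-- **Configuration-style refutations give line-based refutations**: a configuration-style Res(⊕)
refutation with `m` configurations yields an `IsResLinRefutation` with at most `m − 1` lines.
[ABRW 2002, Def. 3.1; Esteban–Torán 2001; Gryaznov–Ovcharov–Riazanov 2024, §2.4] [cite: AlekhnovichBenSassonRazborovWigderson2002, Def. 3.1] -/
theorem exists_isResLinRefutation_of_isResLinSpaceRefutation {φ : CNF ℕ}
    {π : List (Finset LinClause)} (h : IsResLinSpaceRefutation φ π) :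
    ∃ ρ : List ResLinLine, IsResLinRefutation φ ρ ∧ ρ.length + 1 ≤ π.length := by
  obtain ⟨hne, hhead, hchain, hlast⟩ := h
  obtain ⟨M, π', rfl⟩ := List.exists_cons_of_ne_nil hne
  simp only [List.head_cons] at hhead
  subst hhead
  obtain ⟨ρ', hρ', hlen, hcov⟩ := exists_derivation_of_isChain π' ∅ [] hchain
    (fun k hk => absurd hk (by simp)) (by simp)
  obtain ⟨l, hl, hlcl⟩ := hcov ∅ hlast
  refine ⟨ρ', ⟨hρ', l, hl, hlcl⟩, ?_⟩
  simp only [List.length_nil, zero_add] at hlen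
  simp only [List.length_cons]
  omega

/-- The two formats refute the same CNFs. [ABRW 2002, Def. 3.1; Esteban–Torán 2001] [cite: AlekhnovichBenSassonRazborovWigderson2002, Def. 3.1] -/
theorem isResLinSpaceRefutable_iff (φ : CNF ℕ) :
    (∃ π : List (Finset LinClause), IsResLinSpaceRefutation φ π) ↔
      ∃ ρ : List ResLinLine, IsResLinRefutation φ ρ := by
  constructor
  · rintro ⟨π, hπ⟩
    obtain ⟨ρ, hρ, -⟩ := exists_isResLinRefutation_of_isResLinSpaceRefutation hπ
    exact ⟨ρ, hρ⟩
  · rintro ⟨ρ, hρ⟩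
    obtain ⟨π, hπ, -⟩ := exists_isResLinSpaceRefutation_of_isResLinRefutation hρ
    exact ⟨π, hπ⟩

/-- Size comparison in `ℕ∞`: the minimal line-based refutation size is below the length of every
configuration-style refutation. [ABRW 2002, Def. 3.1; Esteban–Torán 2001] [cite: AlekhnovichBenSassonRazborovWigderson2002, Def. 3.1] -/
theorem minResLinRefutationSize_le_length_of_isResLinSpaceRefutation {φ : CNF ℕ}
    {π : List (Finset LinClause)} (h : IsResLinSpaceRefutation φ π) :
    minResLinRefutationSize φ ≤ π.length := by
  obtain ⟨ρ, hρ, hlen⟩ := exists_isResLinRefutation_of_isResLinSpaceRefutation h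
  exact (minResLinRefutationSize_le_length hρ).trans (by exact_mod_cast (by omega : ρ.length ≤ π.length))

end Literature.Computability.MetaComplexity
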